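import Literature.Computability.Cryptography.HallgrenKappaFP
import Literature.Computability.Cryptography.InfrastructureWalkFP
import HarnessLib

/-!
# The walk's defect layer and the `IntWalkOps`/`FPSpec` package of Hallgren's algorithm

Topic `Computability/Cryptography`; completes `HallgrenWalkOps.lean` (labels, unit, `ρ`, `*`, gap
evaluator) with the DEFECT evaluator of the giant step (`HallgrenKappaFP.kappaG`, clamped to the
proven bound `K(D) + 1`, `HallgrenGiantStepBounds.KQ`), and packages everything as the
`IntWalkOps`/`FPSpec` data consumed by the integer walk of `InfrastructureWalkFP.lean`
(Jozsa 2003, §9 Thm. 5: "the ideal I_R to the left of (or at) dR together with the distance gap can be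
computed in poly(log D, log d) time"). Theorem-and-definition file, no named facts.

* `log_two_eq_size_sub_one`; `KQn D` (`KQ` as a natural), `KIntG d = (KQn D + 1)·2ᵖ`, `codeFP_KIntG`;
* `kIntG d a b` — `kappaG` on good instances, clamped to `[−KIntG, KIntG]` — `abs_kIntG_le`,
  `kIntG_eq_of_abs_le`, `codeFP_kIntG`, `length_kIntG_le`;
* **`hallgrenOps : IntWalkOps (ℕ × ℕ) (ℤ × ℤ)`** and **`hallgrenSpec : hallgrenOps.FPSpec dE qE`**
  (validity `ValidL`, bound `6(X+7)(X+2) + 9X + 40`).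

## References

* R. Jozsa, arXiv:quant-ph/0302134 (2003), §9 Thm. 5. [Jozsa2003]
* S. Arora, B. Barak, *Computational Complexity*, CUP 2009, §1.3. [AroraBarak2009]
-/

noncomputable section

open scoped Classical

namespace Literature.Computability.Cryptography

namespace HallgrenGiantStep

open Literature.NumberTheory.QuadraticFields Literature.NumberTheory.QuadraticFields.QuadIrr HallgrenComposition
  InfraPrimitives Literature.Computability.Complexity Literature.Computability.Complexity.CodeFP
  Literature.Computability.Complexity.LogFP Polynomial

variable {D : ℕ}

/-! ### The defect bound as an integer -/

/-- `⌊log₂ D⌋ = size D − 1`. [folklore] -/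
theorem log_two_eq_size_sub_one (D : ℕ) : Nat.log 2 D = D.size - 1 := by
  rcases Nat.eq_zero_or_pos D with rfl | hD
  · simp
  have hs : 0 < D.size := Nat.size_pos.mpr hD
  refine Nat.log_eq_of_pow_le_of_lt_pow ?_ ?_
  · exact Nat.lt_size.mp (by omega)
  · rw [Nat.sub_add_cancel hs]; exact Nat.lt_size_self D

/-- `K(D)` as a natural number. [cite: Jozsa2003, §9] -/
def KQn (D : ℕ) : ℕ := 2 * (D.size - 1 + 7) * (D.size - 1 + 2)

/-- `KQn = KQ`. [folklore] -/
theorem KQn_eq (D : ℕ) : (KQn D : ℚ) = KQ D := by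
  unfold KQn KQ; rw [log_two_eq_size_sub_one]

/-- **The integer defect bound** `(K(D) + 1)·2ᵖ` of the instance `(D, p)`. [cite: Jozsa2003, §9 Thm. 5] -/
def KIntG (d : ℕ × ℕ) : ℕ := (KQn d.1 + 1) * 2 ^ d.2

/-- The defect bound is computable. [folklore] -/
theorem codeFP_KIntG : CodeFP dE natE KIntG := by
  have hD : CodeFP dE natE (fun d => d.1) := fst _ _
  have hp : CodeFP dE unE (fun d => d.2) := snd _ _
  have hs : CodeFP dE natE (fun d => d.1.size - 1) := (natSub.comp ((natOfUn.comp (codeFP_unSize.comp hD)).pair (const _ (1 : ℕ))) :)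
  have hK : CodeFP dE natE (fun d => KQn d.1) :=
    ((natMul.comp ((natMul.comp ((const _ (2 : ℕ)).pair (natAdd.comp (hs.pair (const _ (7 : ℕ)))))).pair
      (natAdd.comp (hs.pair (const _ (2 : ℕ)))))).congr fun d => rfl)
  exact ((natMul.comp ((natAdd.comp (hK.pair (const _ (1 : ℕ)))).pair (natPow.comp ((const _ (2 : ℕ)).pair hp)))).congr
    fun d => rfl)

/-! ### The defect evaluator -/

/-- **The defect evaluator**: the correction program `kappaG` on good instances (else `0`), clamped
to `[−KIntG, KIntG]` so that the bound holds for every input. [cite: Jozsa2003, §9 Thm. 5] -/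
def kIntG (d : ℕ × ℕ) (a b : ℤ × ℤ) : ℤ :=
  max (-(KIntG d : ℤ)) (min (KIntG d : ℤ) (if GoodD d.1 then kappaG d a b else 0))

/-- `|kIntG| ≤ KIntG`. [folklore] -/
theorem abs_kIntG_le (d : ℕ × ℕ) (a b : ℤ × ℤ) : |kIntG d a b| ≤ KIntG d := by
  unfold kIntG
  rw [abs_le]
  constructor
  · exact le_max_left _ _
  · have h0 : (0 : ℤ) ≤ KIntG d := by positivity
    exact max_le (by linarith) (min_le_left _ _)

/-- Within the bound the clamp is inactive. [folklore] -/
theorem kIntG_eq_of_abs_le {d : ℕ × ℕ} (h : GoodD d.1) {a b : ℤ × ℤ} (hk : |kappaG d a b| ≤ KIntG d) :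
    kIntG d a b = kappaG d a b := by
  unfold kIntG
  rw [if_pos h]
  rw [abs_le] at hk
  rw [min_eq_right hk.2, max_eq_right hk.1]

/-- **The defect evaluator is computable.** [cite: Jozsa2003, §9 Thm. 5] [cite: AroraBarak2009, §1.3] -/
theorem codeFP_kIntG : CodeFP (pairE dE (pairE qE qE)) intE (fun c => kIntG c.1 c.2.1 c.2.2) := by
  have hd : CodeFP (pairE dE (pairE qE qE)) dE (fun c => c.1) := fst _ _
  have hK : CodeFP (pairE dE (pairE qE qE)) intE (fun c => (KIntG c.1 : ℤ)) := (intOfNat.comp (codeFP_KIntG.comp hd) :)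
  have hnK : CodeFP (pairE dE (pairE qE qE)) intE (fun c => -(KIntG c.1 : ℤ)) := (intNeg.comp hK :)
  have hg : CodeFP (pairE dE (pairE qE qE)) bitE (fun c => decide (GoodD c.1.1)) := codeFP_goodD.comp hd.fst'
  have hraw : CodeFP (pairE dE (pairE qE qE)) intE (fun c => if GoodD c.1.1 then kappaG c.1 c.2.1 c.2.2 else 0) :=
    (hg.ite codeFP_kappaG (const _ (0 : ℤ))).congr fun c => by by_cases h : GoodD c.1.1 <;> simp [h]
  -- `min` and `max` by comparisons
  have hmin : CodeFP (pairE dE (pairE qE qE)) intE (fun c => min (KIntG c.1 : ℤ) (if GoodD c.1.1 then kappaG c.1 c.2.1 c.2.2 else 0)) :=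
    (((intLe.comp (hK.pair hraw)) :).ite hK hraw).congr fun c => by
      by_cases h : (KIntG c.1 : ℤ) ≤ (if GoodD c.1.1 then kappaG c.1 c.2.1 c.2.2 else 0) <;> simp [h, min_def]
  refine ((((intLe.comp (hnK.pair hmin)) :).ite hmin hnK).congr fun c => ?_)
  unfold kIntG
  by_cases h : -(KIntG c.1 : ℤ) ≤ min (KIntG c.1 : ℤ) (if GoodD c.1.1 then kappaG c.1 c.2.1 c.2.2 else 0) <;>
    simp [h, max_def]

/-- The defect code is short: `|kIntG| ≤ (KQn + 1)2ᵖ < 2^{KQn + 1 + p}`. [folklore] -/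
theorem length_kIntG_le (d : ℕ × ℕ) (a b : ℤ × ℤ) : (intE (kIntG d a b)).length ≤ 3 * (KQn d.1 + 1 + d.2) + 2 := by
  refine (IntWalkOps.length_intE_le (kIntG d a b)).trans ?_
  have h1 : (kIntG d a b).natAbs ≤ KIntG d := by
    have h := abs_kIntG_le d a b
    have : ((kIntG d a b).natAbs : ℤ) ≤ KIntG d := by rw [Int.natCast_natAbs]; exact h
    exact_mod_cast this
  have h2 : (KIntG d).size ≤ KQn d.1 + 1 + d.2 := by
    unfold KIntG
    refine (IntWalkOps.size_mul_two_pow_le _ _).trans ?_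
    have : (KQn d.1 + 1).size ≤ KQn d.1 + 1 := Nat.size_le.mpr (Nat.lt_two_pow_self)
    omega
  have := Nat.size_le_size h1
  omega

/-! ### The packages -/

/-- **Hallgren's integer walk operations** over instances `(D, p)` with labels `(P, Q)`. [cite: Jozsa2003, §9 Thm. 5] -/
def hallgrenOps : IntWalkOps (ℕ × ℕ) (ℤ × ℤ) where
  unit d := unitG d.1
  rho d a := rhoG d.1 a
  star d a b := starG d.1 a b
  gInt := gIntG
  kInt := kIntG
  KInt := KIntG
  prec d := d.2

/-- **The `FPSpec` of Hallgren's walk**: validity `ValidL`, closed under the steps, with polynomial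
codes and `CodeFP` programs for all operations. [cite: Jozsa2003, §9 Thm. 5] [cite: AroraBarak2009, §1.3] -/
def hallgrenSpec : hallgrenOps.FPSpec dE qE where
  Valid d a := ValidL d.1 a
  valid_unit d := validL_unit d.1
  valid_rho d a ha := validL_rho d.1 a ha
  valid_star d a b ha hb := validL_star d.1 a b ha hb
  bound := 6 * (X + 7) * (X + 2) + 9 * X + 40
  len_lab d a ha := by
    have h := length_le_of_validL ha
    have hX : d.1.size ≤ (dE d).length := by
      simp only [pairE_apply, length_boolPair, length_natE]; omega
    simp only [eval_add, eval_mul, eval_X, eval_ofNat]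
    nlinarith
  len_g d a ha := by
    have h := length_gIntG_le d ha
    have hX : d.1.size + d.2 ≤ (dE d).length := by
      simp only [pairE_apply, length_boolPair, length_natE, length_unE]; omega
    show (intE (gIntG d a)).length ≤ _
    simp only [eval_add, eval_mul, eval_X, eval_ofNat]
    nlinarith
  len_k d a b _ _ := by
    have h := length_kIntG_le d a b
    have hX : d.1.size + d.2 ≤ (dE d).length := by
      simp only [pairE_apply, length_boolPair, length_natE, length_unE]; omega
    show (intE (kIntG d a b)).length ≤ _
    simp only [eval_add, eval_mul, eval_X, eval_ofNat]
    have hK : KQn d.1 ≤ 2 * ((dE d).length + 7) * ((dE d).length + 2) := by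
      unfold KQn
      have : d.1.size - 1 ≤ (dE d).length := by omega
      exact Nat.mul_le_mul (Nat.mul_le_mul_left _ (by omega)) (by omega)
    nlinarith
  h_unit := (codeFP_unitG.comp (fst _ _) :)
  h_rho := (codeFP_rhoG.comp ((fst _ _).fst'.pair (snd _ _)) :)
  h_star := (codeFP_starG.comp ((fst _ _).fst'.pair (snd _ _)) :)
  h_g := codeFP_gIntG
  h_k := codeFP_kIntG
  h_K := codeFP_KIntG
  h_prec := snd _ _

/-- The rational walk data of an instance. [folklore] -/
theorem hallgrenOps_prec (d : ℕ × ℕ) : hallgrenOps.prec d = d.2 := rfl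

end HallgrenGiantStep

end Literature.Computability.Cryptography

end
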